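import Mathlib.Analysis.SpecialFunctions.Complex.CircleAddChar
import Mathlib.NumberTheory.LegendreSymbol.AddCharacter
import Mathlib.Data.ZMod.Units
import HarnessLib

/-!
# Kloosterman sums to prime-power moduli: the elementary square-root bound

Topic `NumberTheory/LFunctions` (exponential sums). For `q ≥ 1` and `a, b ∈ ℤ/qℤ` the
**Kloosterman sum** is `S(a, b; q) = ∑_{x ∈ (ℤ/qℤ)ˣ} e((a x + b x̄)/q)`, `x x̄ ≡ 1 (mod q)`,
`e(t) = exp(2πit)` (Kloosterman 1926). For a *prime-power* modulus `q = p^m` with `m ≥ 2` the sum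
can be evaluated in closed form by the `p`-adic method of stationary phase (Salié 1932; the
evaluation is reproduced e.g. in Iwaniec–Kowalski, *Analytic Number Theory*, §12.3), and in
particular `|S(a, b; p^m)| ≤ 2 p^{m/2}` for `p` odd, `(ab, p) = 1` — a bound of the same strength
as Weil's bound for `m = 1`, but entirely elementary.

This file proves the elementary bound in the uniform (slightly weaker) form

* `Literature.NumberTheory.LFunctions.norm_kloostermanSum_one_le`: `‖S(1, b; p^m)‖ ≤ 4 · p^{⌈m/2⌉}` for **every** prime `p`
  (including `p = 2`), every `m ≥ 0` and every `b` (for `m ≤ 1` this is weaker than the trivial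
  bound, and Weil's bound is never used).

Proof: write `x = u + p^k v` with `k = ⌈m/2⌉`, `u mod p^k`, `v mod p^l`, `l = ⌊m/2⌋`. Since
`p^{2k} ≡ 0`, `x̄ = ū - p^k v ū²` (`ZMod.inv_add_mul_of_sq_eq_zero`), so
`e((x + b x̄)/p^m) = e((u + b ū)/p^m) e(v (1 - b ū²)/p^l)` and the sum over `v` is `p^l` or `0`
according as `u² ≡ b (mod p^l)` or not (`sum_range_stdAddChar_pow_mul`, orthogonality of additive
characters). The congruence `w² ≡ b (mod p^l)` has at most `4` unit solutions
(`card_filter_isUnit_and_mul_inv_sq_eq_one_le`: `≤ 2` for odd `p` since `(w - w₀)(w + w₀) = 0`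
with `2 w₀` a unit; `≤ 4` for `p = 2` by a `2`-adic valuation count), whence at most `4 p^{k-l}`
solutions `u mod p^k`, and `‖S‖ ≤ p^l · 4 p^{k-l} = 4 p^k`.

This bound is the input for the Galois-average of root numbers `ε χ(N) τ(χ)²/p^m` of the twists
`f ⊗ χ` of a weight-`2` newform by the characters `χ` of `p`-power conductor and order
(`Literature.NumberTheory.EllipticCurves.PAdicLFunctionMomentProofs`, after Rohrlich 1984).

## Design notes

* `kloostermanSum q a b` is written as a sum over all of `ZMod q` with the non-units omitted by an
  `if`, using Mathlib's total inverse `x⁻¹` on `ZMod q` (the genuine inverse on units); this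
  avoids coercions from `(ZMod q)ˣ` in reindexing arguments.
* Mathlib has Gauss sums (`gaussSum`) and the additive characters `ZMod.stdAddChar`, but no
  Kloosterman sums (searched `kloosterman`, `Kloosterman` in Mathlib and the project).

## References

* H. D. Kloosterman, *On the representation of numbers in the form `ax² + by² + cz² + dt²`*,
  Acta Math. 49 (1926), 407–464.
* H. Salié, *Über die Kloostermanschen Summen `S(u, v; q)`*, Math. Z. 34 (1932), 91–109.
* H. Iwaniec, *Spectral methods of automorphic forms*, 2nd ed., AMS GSM 53 (2002), §2.5, (2.23).
* H. Iwaniec, E. Kowalski, *Analytic Number Theory*, AMS Colloquium Publ. 53 (2004), §12.3.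
-/

noncomputable section

open scoped BigOperators
open Finset

namespace Literature.NumberTheory.LFunctions

/-- The **Kloosterman sum** `S(a, b; q) = ∑_{x ∈ (ℤ/qℤ)ˣ} e((a x + b x⁻¹)/q)` (Kloosterman 1926;
Iwaniec, *Spectral methods*, (2.23) with `Γ = SL₂(ℤ)`), written as a sum over `ℤ/qℤ` with the
non-units omitted (`x⁻¹` is Mathlib's total inverse on `ZMod q`, the genuine inverse on units).
[folklore] -/
def kloostermanSum (q : ℕ) [NeZero q] (a b : ZMod q) : ℂ :=
  by classical exact ∑ x : ZMod q, if IsUnit x then (ZMod.stdAddChar (a * x + b * x⁻¹) : ℂ) else 0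

/-- A sum over `ℤ/qℤ` (`q ≠ 0`) is the sum over the representatives `0, …, q - 1`. [folklore] -/
theorem sum_zmod_eq_sum_range {M : Type*} [AddCommMonoid M] {q : ℕ} [NeZero q]
    (G : ZMod q → M) : ∑ x : ZMod q, G x = ∑ n ∈ range q, G n := by
  refine Finset.sum_bij' (fun x _ ↦ x.val) (fun n _ ↦ (n : ZMod q)) (fun x _ ↦ ?_) (fun n hn ↦ ?_)
    (fun x _ ↦ ?_) (fun n hn ↦ ?_) (fun x _ ↦ ?_)
  · exact mem_range.mpr (ZMod.val_lt x)
  · exact mem_univ _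
  · exact ZMod.natCast_zmod_val x
  · exact ZMod.val_cast_of_lt (mem_range.mp hn)
  · rw [ZMod.natCast_zmod_val]

/-- `∑_{n < a b} H(n) = ∑_{u < a} ∑_{v < b} H(u + a v)` (division with remainder). [folklore] -/
theorem sum_range_mul_eq_sum_sum {M : Type*} [AddCommMonoid M] (a b : ℕ) (H : ℕ → M) :
    ∑ n ∈ range (a * b), H n = ∑ u ∈ range a, ∑ v ∈ range b, H (u + a * v) := by
  rcases Nat.eq_zero_or_pos a with rfl | ha
  · simp
  rw [← Finset.sum_product']
  refine Finset.sum_bij' (fun n _ ↦ (n % a, n / a)) (fun uv _ ↦ uv.1 + a * uv.2) (fun n hn ↦ ?_)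
    (fun uv huv ↦ ?_) (fun n _ ↦ Nat.mod_add_div n a) (fun uv huv ↦ ?_) (fun n _ ↦ ?_)
  · rw [mem_range] at hn
    simp only [mem_product, mem_range]
    exact ⟨Nat.mod_lt _ ha, Nat.div_lt_of_lt_mul hn⟩
  · simp only [mem_product, mem_range] at huv
    rw [mem_range]
    calc uv.1 + a * uv.2 < a + a * uv.2 := by omega
      _ = a * (uv.2 + 1) := by ring
      _ ≤ a * b := Nat.mul_le_mul_left a huv.2
  · simp only [mem_product, mem_range] at huv
    ext
    · simp [Nat.add_mul_mod_self_left, Nat.mod_eq_of_lt huv.1]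
    · simp [Nat.add_mul_div_left _ _ ha, Nat.div_eq_of_lt huv.1]
  · simp [Nat.mod_add_div n a]


/-! ### Units and inverses in `ℤ/p^lℤ` -/

section PrimePow

variable {p : ℕ} [hp : Fact p.Prime]

/-- In `ℤ/p^lℤ` (`l ≥ 1`) an element is a unit iff its reduction mod `p` is non-zero. [folklore] -/
theorem isUnit_iff_cast_ne_zero {l : ℕ} (hl : l ≠ 0) (x : ZMod (p ^ l)) :
    IsUnit x ↔ (ZMod.castHom (dvd_pow_self p hl) (ZMod p) x) ≠ 0 := by
  haveI : NeZero (p ^ l) := ⟨pow_ne_zero _ hp.out.ne_zero⟩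
  conv_lhs => rw [← ZMod.natCast_zmod_val x]
  rw [ZMod.isUnit_iff_coprime, Nat.coprime_pow_right_iff (Nat.pos_of_ne_zero hl), Nat.coprime_comm,
    hp.out.coprime_iff_not_dvd, ZMod.castHom_apply, ← ZMod.natCast_val, Ne,
    ZMod.natCast_eq_zero_iff]

/-- A natural number is a unit in `ℤ/p^lℤ` as soon as `p ∤ n`. [folklore] -/
theorem isUnit_natCast_of_not_dvd {l : ℕ} {n : ℕ} (hn : ¬ p ∣ n) : IsUnit ((n : ℕ) : ZMod (p ^ l)) := by
  rw [ZMod.isUnit_iff_coprime]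
  exact (hp.out.coprime_iff_not_dvd.mpr hn).symm.pow_right l

/-- For `l ≥ 1`, `n` is a unit in `ℤ/p^lℤ` iff `p ∤ n`. [folklore] -/
theorem isUnit_natCast_iff_not_dvd {l : ℕ} (hl : l ≠ 0) (n : ℕ) :
    IsUnit ((n : ℕ) : ZMod (p ^ l)) ↔ ¬ p ∣ n := by
  rw [ZMod.isUnit_iff_coprime, Nat.coprime_pow_right_iff (Nat.pos_of_ne_zero hl), Nat.coprime_comm,
    hp.out.coprime_iff_not_dvd]

omit hp in
/-- Ring homomorphisms out of `ZMod q` commute with the total inverse on units. [folklore] -/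
theorem ZMod.cast_inv_of_isUnit {q q' : ℕ} (h : q' ∣ q) {x : ZMod q} (hx : IsUnit x) :
    (ZMod.cast (x⁻¹ : ZMod q) : ZMod q') = (ZMod.cast x : ZMod q')⁻¹ := by
  symm
  apply ZMod.inv_eq_of_mul_eq_one
  rw [← ZMod.cast_mul h, ZMod.mul_inv_of_unit x hx, ZMod.cast_one h]

omit hp in
/-- **Inverse of a perturbation by a square-zero element**: if `P² = 0` in `ZMod q` and `u` is a
unit with (total) inverse `u⁻¹`, then `(u + P v)⁻¹ = u⁻¹ - P v u⁻²`. [folklore] -/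
theorem ZMod.inv_add_mul_of_sq_eq_zero {q : ℕ} {u P : ZMod q} (hu : IsUnit u) (hP : P ^ 2 = 0)
    (v : ZMod q) : (u + P * v)⁻¹ = u⁻¹ - P * v * u⁻¹ ^ 2 := by
  apply ZMod.inv_eq_of_mul_eq_one
  have huu : u * u⁻¹ = 1 := ZMod.mul_inv_of_unit u hu
  linear_combination (1 - P * v * u⁻¹) * huu - v ^ 2 * u⁻¹ ^ 2 * hP

/-- Square roots of a unit in `ℤ/p^lℤ`, `p` odd: `w² = w₀²` forces `w = ± w₀`. [folklore] -/
theorem eq_or_eq_neg_of_sq_eq_sq_of_odd (hp2 : p ≠ 2) {l : ℕ} {w w₀ : ZMod (p ^ l)} (hw₀ : IsUnit w₀)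
    (h : w ^ 2 = w₀ ^ 2) : w = w₀ ∨ w = -w₀ := by
  rcases Nat.eq_zero_or_pos l with rfl | hl
  · left
    haveI : Subsingleton (ZMod (p ^ 0)) := by rw [pow_zero]; infer_instance
    exact Subsingleton.elim _ _
  have hde : (w - w₀) * (w + w₀) = 0 := by linear_combination h
  by_cases hd : IsUnit (w - w₀)
  · right
    have h0 : w + w₀ = 0 := by
      have := congr_arg ((w - w₀)⁻¹ * ·) hde
      simpa only [← mul_assoc, ZMod.inv_mul_of_unit _ hd, one_mul, mul_zero] using this
    linear_combination h0
  · left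
    set π := ZMod.castHom (dvd_pow_self p hl.ne') (ZMod p) with hπ
    rw [isUnit_iff_cast_ne_zero hl.ne', not_not] at hd
    have he : IsUnit (w + w₀) := by
      rw [isUnit_iff_cast_ne_zero hl.ne']
      have h2 : (2 : ZMod p) ≠ 0 := by
        change ((2 : ℕ) : ZMod p) ≠ 0
        rw [Ne, ZMod.natCast_eq_zero_iff, Nat.prime_dvd_prime_iff_eq hp.out Nat.prime_two]
        exact hp2
      have hw0 : π w₀ ≠ 0 := (isUnit_iff_cast_ne_zero hl.ne' w₀).mp hw₀
      have : π (w + w₀) = π (w - w₀) + 2 * π w₀ := by rw [map_add, map_sub]; ring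
      rw [this, hd, zero_add]
      exact mul_ne_zero h2 hw0
    have h0 : w - w₀ = 0 := by
      have := congr_arg (· * (w + w₀)⁻¹) hde
      simpa only [mul_assoc, ZMod.mul_inv_of_unit _ he, mul_one, zero_mul] using this
    linear_combination h0


omit hp in
/-- In `ℤ/2^lℤ`, an integer multiple of `2^{l-1}` is `0` or `2^{l-1}`. [folklore] -/
theorem intCast_two_pow_mul_eq {l : ℕ} (hl : l ≠ 0) (s : ℤ) :
    (((2 : ℤ) ^ (l - 1) * s : ℤ) : ZMod (2 ^ l)) = 0 ∨
      (((2 : ℤ) ^ (l - 1) * s : ℤ) : ZMod (2 ^ l)) = ((2 ^ (l - 1) : ℕ) : ZMod (2 ^ l)) := by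
  have h2l : (2 : ZMod (2 ^ l)) ^ l = 0 := by exact_mod_cast ZMod.natCast_self (2 ^ l)
  have hpow : (2 : ℤ) ^ l = 2 ^ (l - 1) * 2 := by
    rw [← pow_succ, Nat.sub_add_cancel (Nat.pos_of_ne_zero hl)]
  obtain ⟨r, rfl | rfl⟩ := Int.even_or_odd' s
  · left
    have : (2 : ℤ) ^ (l - 1) * (2 * r) = 2 ^ l * r := by rw [hpow]; ring
    rw [this]
    push_cast
    rw [h2l, zero_mul]
  · right
    have : (2 : ℤ) ^ (l - 1) * (2 * r + 1) = 2 ^ l * r + 2 ^ (l - 1) := by rw [hpow]; ring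
    rw [this]
    push_cast
    rw [h2l, zero_mul, zero_add]

/-- Square roots of a unit in `ℤ/2^lℤ`: `w² = w₀²` forces `w ∈ {± w₀, ± w₀ + 2^{l-1}}`. [folklore] -/
theorem mem_of_sq_eq_sq_two {l : ℕ} (hl : l ≠ 0) {w w₀ : ZMod (2 ^ l)} (hw₀ : IsUnit w₀)
    (h : w ^ 2 = w₀ ^ 2) :
    w = w₀ ∨ w = -w₀ ∨ w = w₀ + ((2 ^ (l - 1) : ℕ) : ZMod (2 ^ l)) ∨
      w = -w₀ + ((2 ^ (l - 1) : ℕ) : ZMod (2 ^ l)) := by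
  haveI : Fact (Nat.Prime 2) := ⟨Nat.prime_two⟩
  haveI : NeZero (2 ^ l) := ⟨pow_ne_zero _ two_ne_zero⟩
  have hw : IsUnit w := by
    have h2 : IsUnit (w ^ 2) := by rw [h]; exact hw₀.pow 2
    exact (isUnit_pow_iff two_ne_zero).mp h2
  -- integer lifts
  set a : ℤ := (w.val : ℤ) with ha
  set c : ℤ := (w₀.val : ℤ) with hc
  have haw : (a : ZMod (2 ^ l)) = w := by rw [ha, Int.cast_natCast, ZMod.natCast_zmod_val]
  have hcw : (c : ZMod (2 ^ l)) = w₀ := by rw [hc, Int.cast_natCast, ZMod.natCast_zmod_val]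
  have hodd : ∀ {x : ZMod (2 ^ l)}, IsUnit x → Odd (x.val : ℤ) := by
    intro x hx
    rw [Int.odd_coe_nat, ← Nat.not_even_iff_odd, even_iff_two_dvd]
    rw [← ZMod.natCast_zmod_val x] at hx
    exact (isUnit_natCast_iff_not_dvd hl x.val).mp hx
  have hao : Odd a := hodd hw
  have hco : Odd c := hodd hw₀
  have hdvd : (2 : ℤ) ^ l ∣ (a - c) * (a + c) := by
    have : ((((a - c) * (a + c)) : ℤ) : ZMod (2 ^ l)) = 0 := by
      push_cast
      rw [haw, hcw]
      linear_combination h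
    rw [ZMod.intCast_zmod_eq_zero_iff_dvd] at this
    exact_mod_cast this
  have hl' : (2 : ℤ) ^ l = 2 * 2 ^ (l - 1) := by
    rw [mul_comm, ← pow_succ, Nat.sub_add_cancel (Nat.pos_of_ne_zero hl)]
  -- `a - c` and `a + c` are even, not both divisible by `4`
  obtain ⟨α, hα⟩ := hao
  obtain ⟨γ, hγ⟩ := hco
  have key : ∀ {x y : ℤ}, (2 : ℤ) ^ l ∣ x * y → (∃ t, x = 2 * t ∧ Odd t) → (2 : ℤ) ^ (l - 1) ∣ y := by
    rintro x y hxy ⟨t, rfl, ht⟩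
    rw [hl', mul_assoc] at hxy
    have h1 : (2 : ℤ) ^ (l - 1) ∣ t * y := (mul_dvd_mul_iff_left two_ne_zero).mp hxy
    have hcop : IsCoprime ((2 : ℤ) ^ (l - 1)) t := by
      obtain ⟨s, rfl⟩ := ht
      exact (show IsCoprime (2 : ℤ) (2 * s + 1) from ⟨-s, 1, by ring⟩).pow_left
    exact hcop.dvd_of_dvd_mul_left h1
  by_cases h4 : (4 : ℤ) ∣ a - c
  · -- then `a + c = 2 * odd`
    have hy : ∃ t, a + c = 2 * t ∧ Odd t := ⟨α + γ + 1, by omega, by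
      obtain ⟨δ, hδ⟩ := h4
      exact ⟨γ + δ, by omega⟩⟩
    have hd : (2 : ℤ) ^ (l - 1) ∣ a - c := key (by rwa [mul_comm] at hdvd) hy
    obtain ⟨s, hs⟩ := hd
    have hws : w - w₀ = (((2 : ℤ) ^ (l - 1) * s : ℤ) : ZMod (2 ^ l)) := by
      rw [← hs]; push_cast; rw [haw, hcw]
    rcases intCast_two_pow_mul_eq hl s with h0 | h0 <;> rw [h0] at hws
    · left; linear_combination hws
    · right; right; left; linear_combination hws
  · have hx : ∃ t, a - c = 2 * t ∧ Odd t := ⟨α - γ, by omega, by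
      refine Int.odd_iff.mpr ?_
      omega⟩
    have he : (2 : ℤ) ^ (l - 1) ∣ a + c := key hdvd hx
    obtain ⟨s, hs⟩ := he
    have hws : w + w₀ = (((2 : ℤ) ^ (l - 1) * s : ℤ) : ZMod (2 ^ l)) := by
      rw [← hs]; push_cast; rw [haw, hcw]
    rcases intCast_two_pow_mul_eq hl s with h0 | h0 <;> rw [h0] at hws
    · right; left; linear_combination hws
    · right; right; right; linear_combination hws


/-- At most four square roots: for any `b ∈ ℤ/p^lℤ`, the units `w` with `b w⁻² = 1` (i.e.
`w² = b`) number at most `4` (`≤ 2` for odd `p`). [folklore] -/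
theorem card_filter_isUnit_and_mul_inv_sq_eq_one_le (l : ℕ) (b : ZMod (p ^ l)) :
    (Finset.univ.filter fun w : ZMod (p ^ l) ↦ IsUnit w ∧ b * w⁻¹ ^ 2 = 1).card ≤ 4 := by
  classical
  by_cases hex : ∃ w₀ : ZMod (p ^ l), IsUnit w₀ ∧ b * w₀⁻¹ ^ 2 = 1
  swap
  · rw [Finset.filter_false_of_mem, Finset.card_empty]
    · exact Nat.zero_le _
    · exact fun w _ hw ↦ hex ⟨w, hw⟩
  obtain ⟨w₀, hw₀, hb₀⟩ := hex
  have hsq : ∀ w : ZMod (p ^ l), IsUnit w ∧ b * w⁻¹ ^ 2 = 1 → w ^ 2 = w₀ ^ 2 := by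
    rintro w ⟨hw, hb⟩
    have h1 : w₀⁻¹ * w₀ = 1 := ZMod.inv_mul_of_unit w₀ hw₀
    have h2 : w⁻¹ * w = 1 := ZMod.inv_mul_of_unit w hw
    have hb' : b = w₀ ^ 2 := by
      linear_combination (-b * (w₀⁻¹ * w₀ + 1)) * h1 + w₀ ^ 2 * hb₀
    linear_combination (-w ^ 2) * hb + (b * (w⁻¹ * w + 1)) * h2 + hb'
  by_cases hp2 : p = 2
  · subst hp2
    rcases Nat.eq_zero_or_pos l with rfl | hl
    · calc _ ≤ Fintype.card (ZMod (2 ^ 0)) := Finset.card_le_univ _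
        _ = 1 := by simp
        _ ≤ 4 := by norm_num
    calc _ ≤ ({w₀, -w₀, w₀ + ((2 ^ (l - 1) : ℕ) : ZMod (2 ^ l)),
              -w₀ + ((2 ^ (l - 1) : ℕ) : ZMod (2 ^ l))} : Finset (ZMod (2 ^ l))).card := by
          refine Finset.card_le_card fun w hw ↦ ?_
          rw [Finset.mem_filter] at hw
          simp only [Finset.mem_insert, Finset.mem_singleton]
          rcases mem_of_sq_eq_sq_two hl.ne' hw₀ (hsq w hw.2) with h | h | h | h <;>
            simp only [h, true_or, or_true]
      _ ≤ 4 := Finset.card_le_four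
  · calc _ ≤ ({w₀, -w₀} : Finset (ZMod (p ^ l))).card := by
          refine Finset.card_le_card fun w hw ↦ ?_
          rw [Finset.mem_filter] at hw
          simp only [Finset.mem_insert, Finset.mem_singleton]
          rcases eq_or_eq_neg_of_sq_eq_sq_of_odd hp2 hw₀ (hsq w hw.2) with h | h <;>
            simp only [h, true_or, or_true]
      _ ≤ 2 := Finset.card_le_two
      _ ≤ 4 := by norm_num


/-! ### Stationary phase for `S(1, b; p^m)` -/

/-- `e(n / N)` for a natural number `n` (Mathlib `ZMod.stdAddChar_coe` for `ℕ`). [folklore] -/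
theorem stdAddChar_natCast (N n : ℕ) [NeZero N] :
    (ZMod.stdAddChar ((n : ℕ) : ZMod N) : ℂ) = Complex.exp (2 * Real.pi * Complex.I * n / N) := by
  rw [show ((n : ℕ) : ZMod N) = ((n : ℤ) : ZMod N) by simp, ZMod.stdAddChar_coe]
  norm_cast

omit hp in
/-- `‖e(x/N)‖ = 1`. [folklore] -/
theorem norm_stdAddChar {N : ℕ} [NeZero N] (x : ZMod N) : ‖(ZMod.stdAddChar x : ℂ)‖ = 1 := by
  rw [ZMod.stdAddChar_apply, Circle.norm_coe]

/-- `e(p^k z / p^{k+l}) = e(z / p^l)`. [folklore] -/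
theorem stdAddChar_pow_mul_natCast {k l m : ℕ} (hklm : k + l = m) (z : ℕ) :
    (ZMod.stdAddChar ((p ^ k * z : ℕ) : ZMod (p ^ m)) : ℂ) =
      ZMod.stdAddChar ((z : ℕ) : ZMod (p ^ l)) := by
  rw [stdAddChar_natCast, stdAddChar_natCast]
  congr 1
  have hp0 : (p : ℂ) ≠ 0 := Nat.cast_ne_zero.mpr hp.out.ne_zero
  rw [← hklm]
  push_cast
  field_simp
  ring

/-- **The inner sum of the stationary-phase decomposition**: for `w ∈ ℤ/p^mℤ`, `m = k + l`,
`∑_{v < p^l} e(p^k v w / p^m) = ∑_{v mod p^l} e(v w / p^l)` is `p^l` if `w ≡ 0 (mod p^l)` and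
`0` otherwise (orthogonality of additive characters, Mathlib `AddChar.sum_mulShift`). [folklore] -/
theorem sum_range_stdAddChar_pow_mul {k l m : ℕ} (hklm : k + l = m) (w : ZMod (p ^ m)) :
    ∑ v ∈ range (p ^ l),
        (ZMod.stdAddChar (((p ^ k : ℕ) : ZMod (p ^ m)) * ((v : ℕ) : ZMod (p ^ m)) * w) : ℂ) =
      if ZMod.castHom (pow_dvd_pow p (hklm ▸ Nat.le_add_left l k)) (ZMod (p ^ l)) w = 0
        then ((p ^ l : ℕ) : ℂ) else 0 := by
  classical
  set c : ZMod (p ^ l) := ZMod.castHom (pow_dvd_pow p (hklm ▸ Nat.le_add_left l k)) (ZMod (p ^ l)) w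
    with hc
  have hterm : ∀ v : ℕ, (ZMod.stdAddChar (((p ^ k : ℕ) : ZMod (p ^ m)) * ((v : ℕ) : ZMod (p ^ m)) * w) : ℂ) =
      ZMod.stdAddChar (((v : ℕ) : ZMod (p ^ l)) * c) := by
    intro v
    have h1 : ((p ^ k : ℕ) : ZMod (p ^ m)) * ((v : ℕ) : ZMod (p ^ m)) * w =
        ((p ^ k * (v * w.val) : ℕ) : ZMod (p ^ m)) := by
      conv_lhs => rw [← ZMod.natCast_zmod_val w]
      push_cast
      ring
    have h2 : ((v : ℕ) : ZMod (p ^ l)) * c = ((v * w.val : ℕ) : ZMod (p ^ l)) := by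
      rw [hc, ZMod.castHom_apply, ← ZMod.natCast_val]
      push_cast
      ring
    rw [h1, stdAddChar_pow_mul_natCast hklm, h2]
  simp_rw [hterm]
  rw [← sum_zmod_eq_sum_range (fun y : ZMod (p ^ l) ↦ (ZMod.stdAddChar (y * c) : ℂ)),
    AddChar.sum_mulShift c (ZMod.isPrimitive_stdAddChar (p ^ l)), ZMod.card]
  split_ifs <;> simp


/-- `u + p^k v` is a unit mod `p^m` iff `u` is (`k ≥ 1`, or `m = 0`). [folklore] -/
theorem isUnit_natCast_add_pow_mul_iff {k m : ℕ} (hk : m = 0 ∨ k ≠ 0) (u v : ℕ) :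
    IsUnit ((u + p ^ k * v : ℕ) : ZMod (p ^ m)) ↔ IsUnit ((u : ℕ) : ZMod (p ^ m)) := by
  rcases Nat.eq_zero_or_pos m with rfl | hm
  · haveI : Subsingleton (ZMod (p ^ 0)) := by rw [pow_zero]; infer_instance
    exact ⟨fun _ ↦ isUnit_of_subsingleton _, fun _ ↦ isUnit_of_subsingleton _⟩
  have hk' : k ≠ 0 := hk.resolve_left hm.ne'
  rw [isUnit_natCast_iff_not_dvd hm.ne', isUnit_natCast_iff_not_dvd hm.ne',
    Nat.dvd_add_left ((dvd_pow_self p hk').mul_right v)]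

/-- **One term of the stationary-phase decomposition.** For a unit `u` mod `p^m`, `m ≤ 2k`, and
`x = u + p^k v`: `x⁻¹ = u⁻¹ - p^k v u⁻²`, so
`e((x + b x⁻¹)/p^m) = e((u + b u⁻¹)/p^m) · e(p^k v (1 - b u⁻²)/p^m)`. [folklore] -/
theorem stdAddChar_kloosterman_term {k m : ℕ} (hm : m ≤ 2 * k) (b : ZMod (p ^ m)) (u v : ℕ)
    (hu : IsUnit ((u : ℕ) : ZMod (p ^ m))) :
    (ZMod.stdAddChar (1 * ((u + p ^ k * v : ℕ) : ZMod (p ^ m)) +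
        b * ((u + p ^ k * v : ℕ) : ZMod (p ^ m))⁻¹) : ℂ) =
      ZMod.stdAddChar (((u : ℕ) : ZMod (p ^ m)) + b * ((u : ℕ) : ZMod (p ^ m))⁻¹) *
        ZMod.stdAddChar (((p ^ k : ℕ) : ZMod (p ^ m)) * ((v : ℕ) : ZMod (p ^ m)) *
          (1 - b * ((u : ℕ) : ZMod (p ^ m))⁻¹ ^ 2)) := by
  have hP : (((p ^ k : ℕ) : ZMod (p ^ m))) ^ 2 = 0 := by
    rw [← Nat.cast_pow, ZMod.natCast_eq_zero_iff, ← pow_mul]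
    exact pow_dvd_pow p (by omega)
  have hx : ((u + p ^ k * v : ℕ) : ZMod (p ^ m)) =
      ((u : ℕ) : ZMod (p ^ m)) + ((p ^ k : ℕ) : ZMod (p ^ m)) * ((v : ℕ) : ZMod (p ^ m)) := by
    push_cast; ring
  rw [hx, ZMod.inv_add_mul_of_sq_eq_zero hu hP, ← AddChar.map_add_eq_mul]
  congr 1
  ring

/-- Counting over a range of length `p^k = p^l · p^{k-l}` a property of the residue mod `p^l`.
[folklore] -/
theorem card_filter_range_pow_eq {k l : ℕ} (hlk : l ≤ k) (Q : ZMod (p ^ l) → Prop)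
    [DecidablePred Q] :
    ((range (p ^ k)).filter fun u : ℕ ↦ Q (u : ZMod (p ^ l))).card =
      p ^ (k - l) * (Finset.univ.filter Q).card := by
  rw [Finset.card_filter, Finset.card_filter, show p ^ k = p ^ l * p ^ (k - l) by
    rw [← pow_add, Nat.add_sub_cancel' hlk], sum_range_mul_eq_sum_sum, Finset.mul_sum,
    sum_zmod_eq_sum_range]
  refine Finset.sum_congr rfl fun w _ ↦ ?_
  have h : ∀ j : ℕ, ((w + p ^ l * j : ℕ) : ZMod (p ^ l)) = (w : ZMod (p ^ l)) := by
    intro j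
    have h0 : ((p : ZMod (p ^ l))) ^ l = 0 := by exact_mod_cast ZMod.natCast_self (p ^ l)
    push_cast
    rw [h0, zero_mul, add_zero]
  simp_rw [h]
  rw [Finset.sum_const, Finset.card_range, smul_eq_mul]

/-- **Kloosterman sums to prime-power moduli: the elementary square-root bound**
`|S(1, b; p^m)| ≤ 4 p^{⌈m/2⌉}` for every prime `p`, `m ≥ 0` and `b ∈ ℤ/p^mℤ` (Salié 1932;
Iwaniec–Kowalski, *Analytic Number Theory*, §12.3; for odd `p` the constant `4` can be replaced by
`2`, and for `m = 1` this is weaker than Weil's bound, which is not needed here). Proof (stationary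
phase): write `x = u + p^k v` with `k = ⌈m/2⌉`, `u mod p^k`, `v mod p^l`, `l = ⌊m/2⌋`; then
`x⁻¹ = u⁻¹ - p^k v u⁻²`, the sum over `v` is `p^l · 𝟙[u² ≡ b (mod p^l)]`, and `u² ≡ b` has at
most `4 p^{k-l}` solutions `u mod p^k`. [folklore] -/
theorem norm_kloostermanSum_one_le (m : ℕ) (b : ZMod (p ^ m)) :
    ‖kloostermanSum (p ^ m) 1 b‖ ≤ 4 * (p : ℝ) ^ (m - m / 2) := by
  classical
  set k := m - m / 2 with hk
  set l := m / 2 with hl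
  have hklm : k + l = m := by omega
  have hlk : l ≤ k := by omega
  have hm2 : m ≤ 2 * k := by omega
  have hk0 : m = 0 ∨ k ≠ 0 := by omega
  have hdvd : p ^ l ∣ p ^ m := pow_dvd_pow p (by omega)
  -- abbreviations
  set ψ : ZMod (p ^ m) → ℂ := fun x ↦ (ZMod.stdAddChar x : ℂ) with hψ
  set U : ℕ → ZMod (p ^ m) := fun u ↦ ((u : ℕ) : ZMod (p ^ m)) with hU
  set π := ZMod.castHom hdvd (ZMod (p ^ l)) with hπ
  set Q : ZMod (p ^ l) → Prop := fun w ↦ IsUnit w ∧ π b * w⁻¹ ^ 2 = 1 with hQ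
  -- Step 1: the stationary-phase formula
  have hS : kloostermanSum (p ^ m) 1 b = ∑ u ∈ range (p ^ k),
      if IsUnit (U u) then ψ (U u + b * (U u)⁻¹) *
        (if π (1 - b * (U u)⁻¹ ^ 2) = 0 then ((p ^ l : ℕ) : ℂ) else 0) else 0 := by
    have hpm : range (p ^ m) = range (p ^ k * p ^ l) := by rw [← pow_add, hklm]
    rw [kloostermanSum, sum_zmod_eq_sum_range, hpm, sum_range_mul_eq_sum_sum]
    refine Finset.sum_congr rfl fun u _ ↦ ?_
    by_cases hu : IsUnit (U u)
    · rw [if_pos hu, ← sum_range_stdAddChar_pow_mul hklm, Finset.mul_sum]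
      refine Finset.sum_congr rfl fun v _ ↦ ?_
      rw [if_pos ((isUnit_natCast_add_pow_mul_iff hk0 u v).mpr hu),
        stdAddChar_kloosterman_term hm2 b u v hu]
    · rw [if_neg hu]
      refine Finset.sum_eq_zero fun v _ ↦ ?_
      rw [if_neg (mt (isUnit_natCast_add_pow_mul_iff hk0 u v).mp hu)]
  -- Step 2: norms
  have hnorm : ‖kloostermanSum (p ^ m) 1 b‖ ≤
      ∑ u ∈ range (p ^ k), if Q (u : ZMod (p ^ l)) then ((p ^ l : ℕ) : ℝ) else 0 := by
    rw [hS]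
    refine (norm_sum_le _ _).trans (Finset.sum_le_sum fun u _ ↦ ?_)
    by_cases hu : IsUnit (U u)
    · rw [if_pos hu]
      by_cases h0 : π (1 - b * (U u)⁻¹ ^ 2) = 0
      · have hQu : Q (u : ZMod (p ^ l)) := by
          refine ⟨?_, ?_⟩
          · have := hu.map π
            rwa [hπ, ZMod.castHom_apply, hU, ZMod.cast_natCast hdvd] at this
          · rw [map_sub, map_one, map_mul, map_pow, sub_eq_zero, hπ, ZMod.castHom_apply,
              ZMod.castHom_apply, ZMod.cast_inv_of_isUnit hdvd hu, hU,
              ZMod.cast_natCast hdvd] at h0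
            rw [hπ, ZMod.castHom_apply]
            exact h0.symm
        rw [if_pos h0, if_pos hQu, norm_mul, norm_stdAddChar, one_mul, Complex.norm_natCast]
      · rw [if_neg h0, mul_zero, norm_zero]
        split_ifs <;> positivity
    · rw [if_neg hu, norm_zero]
      split_ifs <;> positivity
  -- Step 3: counting
  have hcount : ∑ u ∈ range (p ^ k), (if Q (u : ZMod (p ^ l)) then ((p ^ l : ℕ) : ℝ) else 0) ≤
      ((p ^ l : ℕ) : ℝ) * (p ^ (k - l) * 4) := by
    rw [← Finset.sum_filter, Finset.sum_const, nsmul_eq_mul, mul_comm,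
      card_filter_range_pow_eq hlk Q]
    gcongr
    exact_mod_cast Nat.mul_le_mul_left _ (card_filter_isUnit_and_mul_inv_sq_eq_one_le l (π b))
  refine hnorm.trans (hcount.trans (le_of_eq ?_))
  rw [show (p : ℝ) ^ k = (p : ℝ) ^ l * (p : ℝ) ^ (k - l) by rw [← pow_add, Nat.add_sub_cancel' hlk]]
  push_cast
  ring

end PrimePow

end Literature.NumberTheory.LFunctions
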